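import Mathlib
import Summits.Ventures.PercRepro.TriangleCapStarFamilyTwoDefs
import Summits.Ventures.PercRepro.TriangleCapStarFamilyClasses

/-!
# PercRepro — THE STAR FAMILY WITH TWO SHORT CENTRE ROWS: THE CLASSES AND THE GOOD ENDS (p3, gen 57; part 340)

The classes of the right ends `rfSF2` of part 339 on `Rc + a (D − 1) + Q D` indices (the left ends are `lfSF` of
part 315 with the classes of part 316): the centre row `ℓ + 1 + ρ` has `1 + kSF2 ρ` (`cls_rfSF2_centre_row`), the
outer row `ℓ + 1 + Rc + ρ'` has `a + kSF2 (Rc + ρ')` (`cls_rfSF2_outer_row`), the extra row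
`ℓ + 1 + (Rc + (D − 1) + e)` has `kSF2 (Rc + (D − 1) + e) = D` (`cls_rfSF2_extra_row`), every other right vertex `0`
(`cls_rfSF2_zero`).  The ends are good (`goodEnds_SF2`): the phases are told apart by the left end, a centre pair by
its row, a special pair by `(i mod a, ⌊i / a⌋)`, a regular pair by its block and its residue mod `Q`
(`eq_of_block_mod`, the block sizes being `≤ Q`).  Axioms: standard.
-/
namespace PercRepro

namespace TriangleCap

namespace C047

open Finset

/-- The regular pairs on the row `ℓ + 1 + ρ` (`ρ` below the number of rows) are its block. -/
theorem card_phaseR_row2 (ℓ D a Rc sh0 sh1 E Q ρ : ℕ) (hRc : 2 ≤ Rc) (hsh0 : sh0 + 1 ≤ D) (hsh1 : sh1 + 1 ≤ D)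
    (hinc : Rc * (D - 1) + (D - 1) * (D - a) + E * D = Q * D + (sh0 + sh1)) (hρ : ρ < Rc + (D - 1) + E) :
    ((range (Q * D)).filter (fun i => rfSF2 ℓ D a Rc sh0 sh1 E (Rc + a * (D - 1) + i) = ℓ + 1 + ρ)).card =
      kSF2 D a Rc sh0 sh1 ρ := by
  rw [filter_congr (q := fun i => rfMulti ℓ (kSF2 D a Rc sh0 sh1) (Rc + (D - 1) + E) i = ℓ + 1 + ρ)
      (fun i _ => by rw [rfSF2_phaseR]),
    ← blockSum_kSF2 D a Rc sh0 sh1 E Q hRc hsh0 hsh1 hinc]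
  exact cls_rfMulti ℓ (kSF2 D a Rc sh0 sh1) (Rc + (D - 1) + E) ρ hρ

/-- **THE CLASS OF A CENTRE ROW:** the centre plus its regular block. -/
theorem cls_rfSF2_centre_row (ℓ D a Rc sh0 sh1 E Q ρ : ℕ) (hRc : 2 ≤ Rc) (hsh0 : sh0 + 1 ≤ D) (hsh1 : sh1 + 1 ≤ D)
    (hinc : Rc * (D - 1) + (D - 1) * (D - a) + E * D = Q * D + (sh0 + sh1)) (hρ : ρ < Rc) :
    cls (Rc + a * (D - 1) + Q * D) (rfSF2 ℓ D a Rc sh0 sh1 E) (ℓ + 1 + ρ) = 1 + kSF2 D a Rc sh0 sh1 ρ := by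
  unfold cls
  rw [card_filter_range_add, card_filter_range_add]
  have h1 : ((range Rc).filter (fun i => rfSF2 ℓ D a Rc sh0 sh1 E i = ℓ + 1 + ρ)).card = 1 := by
    rw [filter_congr (q := fun i => i = ρ) (fun i hi => by
        rw [rfSF2_phaseC ℓ D a Rc sh0 sh1 E i (mem_range.mp hi)]
        exact ⟨fun h => by omega, fun h => by omega⟩),
      filter_eq' (range Rc) ρ, if_pos (mem_range.mpr hρ), card_singleton]
  have h2 : ((range (a * (D - 1))).filter (fun i => rfSF2 ℓ D a Rc sh0 sh1 E (Rc + i) = ℓ + 1 + ρ)).card = 0 := by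
    rw [card_eq_zero, filter_eq_empty_iff]
    intro i hi h
    rw [rfSF2_phaseS ℓ D a Rc sh0 sh1 E i (mem_range.mp hi)] at h
    have := Nat.zero_le (i / a)
    omega
  rw [h1, h2, card_phaseR_row2 ℓ D a Rc sh0 sh1 E Q ρ hRc hsh0 hsh1 hinc (by omega)]

/-- **THE CLASS OF AN OUTER ROW:** the `a` specials plus its regular block. -/
theorem cls_rfSF2_outer_row (ℓ D a Rc sh0 sh1 E Q ρ' : ℕ) (ha : 1 ≤ a) (hRc : 2 ≤ Rc) (hsh0 : sh0 + 1 ≤ D) (hsh1 : sh1 + 1 ≤ D)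
    (hinc : Rc * (D - 1) + (D - 1) * (D - a) + E * D = Q * D + (sh0 + sh1)) (hρ' : ρ' < D - 1) :
    cls (Rc + a * (D - 1) + Q * D) (rfSF2 ℓ D a Rc sh0 sh1 E) (ℓ + 1 + Rc + ρ') =
      a + kSF2 D a Rc sh0 sh1 (Rc + ρ') := by
  unfold cls
  rw [card_filter_range_add, card_filter_range_add]
  have h1 : ((range Rc).filter (fun i => rfSF2 ℓ D a Rc sh0 sh1 E i = ℓ + 1 + Rc + ρ')).card = 0 := by
    rw [card_eq_zero, filter_eq_empty_iff]
    intro i hi h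
    rw [rfSF2_phaseC ℓ D a Rc sh0 sh1 E i (mem_range.mp hi)] at h
    have := mem_range.mp hi
    omega
  have h2 : ((range (a * (D - 1))).filter
      (fun i => rfSF2 ℓ D a Rc sh0 sh1 E (Rc + i) = ℓ + 1 + Rc + ρ')).card = a := by
    rw [filter_congr (q := fun i => lfNest a i = 1 + ρ') (fun i hi => by
        rw [rfSF2_phaseS ℓ D a Rc sh0 sh1 E i (mem_range.mp hi)]
        unfold lfNest
        exact ⟨fun h => by omega, fun h => by omega⟩),
      cls_lfNest (a * (D - 1)) a ρ' (by omega)]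
    have hge : a ≤ a * (D - 1) - ρ' * a := by
      have h := Nat.mul_le_mul_right a hρ'
      rw [Nat.succ_mul] at h
      rw [Nat.mul_comm a (D - 1)]
      omega
    omega
  have e : ℓ + 1 + Rc + ρ' = ℓ + 1 + (Rc + ρ') := by omega
  rw [h1, h2, e, card_phaseR_row2 ℓ D a Rc sh0 sh1 E Q (Rc + ρ') hRc hsh0 hsh1 hinc (by omega)]
  omega

/-- **THE CLASS OF AN EXTRA ROW:** its regular block, `D` pairs. -/
theorem cls_rfSF2_extra_row (ℓ D a Rc sh0 sh1 E Q e : ℕ) (ha : 1 ≤ a) (hRc : 2 ≤ Rc) (hsh0 : sh0 + 1 ≤ D) (hsh1 : sh1 + 1 ≤ D)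
    (hinc : Rc * (D - 1) + (D - 1) * (D - a) + E * D = Q * D + (sh0 + sh1)) (he : e < E) :
    cls (Rc + a * (D - 1) + Q * D) (rfSF2 ℓ D a Rc sh0 sh1 E) (ℓ + 1 + (Rc + (D - 1) + e)) = D := by
  unfold cls
  rw [card_filter_range_add, card_filter_range_add]
  have h1 : ((range Rc).filter (fun i => rfSF2 ℓ D a Rc sh0 sh1 E i = ℓ + 1 + (Rc + (D - 1) + e))).card = 0 := by
    rw [card_eq_zero, filter_eq_empty_iff]
    intro i hi h
    rw [rfSF2_phaseC ℓ D a Rc sh0 sh1 E i (mem_range.mp hi)] at h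
    have := mem_range.mp hi
    omega
  have h2 : ((range (a * (D - 1))).filter
      (fun i => rfSF2 ℓ D a Rc sh0 sh1 E (Rc + i) = ℓ + 1 + (Rc + (D - 1) + e))).card = 0 := by
    rw [card_eq_zero, filter_eq_empty_iff]
    intro i hi h
    rw [rfSF2_phaseS ℓ D a Rc sh0 sh1 E i (mem_range.mp hi)] at h
    have hdiv : i / a < D - 1 := by
      rw [Nat.div_lt_iff_lt_mul (by omega)]
      have := Nat.mul_comm a (D - 1)
      have := mem_range.mp hi
      omega
    omega
  rw [h1, h2, card_phaseR_row2 ℓ D a Rc sh0 sh1 E Q (Rc + (D - 1) + e) hRc hsh0 hsh1 hinc (by omega)]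
  unfold kSF2
  rw [if_neg (by omega), if_neg (by omega), if_neg (by omega), if_neg (by omega)]
  omega

/-- The class of a right vertex that is no row is empty. -/
theorem cls_rfSF2_zero (ℓ D a Rc sh0 sh1 E Q y : ℕ) (ha : 1 ≤ a) (hRc : 2 ≤ Rc) (hsh0 : sh0 + 1 ≤ D) (hsh1 : sh1 + 1 ≤ D)
    (hinc : Rc * (D - 1) + (D - 1) * (D - a) + E * D = Q * D + (sh0 + sh1))
    (hy : y < ℓ + 1 ∨ ℓ + 1 + (Rc + (D - 1) + E) ≤ y) :
    cls (Rc + a * (D - 1) + Q * D) (rfSF2 ℓ D a Rc sh0 sh1 E) y = 0 := by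
  unfold cls
  rw [card_eq_zero, filter_eq_empty_iff]
  intro i hi h
  have := rfSF2_bounds ℓ D a Rc sh0 sh1 E Q i ha hRc hsh0 hsh1 hinc (mem_range.mp hi)
  omega

/-- **THE ENDS OF THE STAR FAMILY ARE GOOD** on `n ≥ ℓ + 1 + (Rc + (D − 1) + E)` vertices. -/
theorem goodEnds_SF2 (n ℓ D a Rc sh0 sh1 E Q : ℕ) (ha : 1 ≤ a) (hRc : 2 ≤ Rc) (hsh0 : sh0 + 1 ≤ D) (hsh1 : sh1 + 1 ≤ D) (hQ : 1 ≤ Q)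
    (hQ1 : D ≤ Q + 1) (hQE : 1 ≤ E → D ≤ Q)
    (hinc : Rc * (D - 1) + (D - 1) * (D - a) + E * D = Q * D + (sh0 + sh1)) (hℓ : a + Q + 1 ≤ ℓ)
    (hn : ℓ + 1 + (Rc + (D - 1) + E) ≤ n) :
    GoodEnds n (ℓ + 1) (Rc + a * (D - 1) + Q * D) (lfSF D a Rc Q) (rfSF2 ℓ D a Rc sh0 sh1 E) := by
  refine ⟨fun i _ => ?_, fun i hi => ?_, fun i i' hi hi' h1 h2 => ?_⟩
  · have := lfSF_bounds D a Rc Q i ha hQ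
    omega
  · have := rfSF2_bounds ℓ D a Rc sh0 sh1 E Q i ha hRc hsh0 hsh1 hinc hi
    omega
  · rcases Nat.lt_or_ge i Rc with hC | hC
    · have hC' : i' < Rc := (lfSF_eq_centre_iff D a Rc Q i' ha hQ).mp
        (by rw [← h1]; exact (lfSF_eq_centre_iff D a Rc Q i ha hQ).mpr hC)
      rw [rfSF2_phaseC ℓ D a Rc sh0 sh1 E i hC, rfSF2_phaseC ℓ D a Rc sh0 sh1 E i' hC'] at h2
      omega
    rcases Nat.lt_or_ge i (Rc + a * (D - 1)) with hS | hS
    · have hS' := (lfSF_le_iff D a Rc Q i' ha hQ).mp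
        (by rw [← h1]; exact (lfSF_le_iff D a Rc Q i ha hQ).mpr ⟨hC, hS⟩)
      obtain ⟨j, rfl⟩ : ∃ j, i = Rc + j := ⟨i - Rc, by omega⟩
      obtain ⟨j', rfl⟩ : ∃ j', i' = Rc + j' := ⟨i' - Rc, by omega⟩
      rw [lfSF_phaseS D a Rc Q j (by omega), lfSF_phaseS D a Rc Q j' (by omega)] at h1
      rw [rfSF2_phaseS ℓ D a Rc sh0 sh1 E j (by omega), rfSF2_phaseS ℓ D a Rc sh0 sh1 E j' (by omega)] at h2
      have e1 := Nat.div_add_mod j a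
      have e2 := Nat.div_add_mod j' a
      have h3 : j % a = j' % a := by omega
      have h4 : j / a = j' / a := by omega
      rw [h3, h4] at e1
      omega
    have hR' : Rc + a * (D - 1) ≤ i' := by
      by_contra hcon
      rw [not_le] at hcon
      obtain ⟨p, rfl⟩ : ∃ p, i = Rc + a * (D - 1) + p := ⟨i - Rc - a * (D - 1), by omega⟩
      rw [lfSF_phaseR] at h1
      have hm := Nat.mod_lt p (by omega : 0 < Q)
      have h0 := Nat.zero_le (p % Q)
      rcases Nat.lt_or_ge i' Rc with hC' | hC'
      · rw [lfSF_phaseC D a Rc Q i' hC'] at h1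
        omega
      · obtain ⟨j', rfl⟩ : ∃ j', i' = Rc + j' := ⟨i' - Rc, by omega⟩
        rw [lfSF_phaseS D a Rc Q j' (by omega)] at h1
        have := Nat.mod_lt j' (by omega : 0 < a)
        have := Nat.zero_le (j' % a)
        omega
    obtain ⟨p, rfl⟩ : ∃ p, i = Rc + a * (D - 1) + p := ⟨i - Rc - a * (D - 1), by omega⟩
    obtain ⟨p', rfl⟩ : ∃ p', i' = Rc + a * (D - 1) + p' := ⟨i' - Rc - a * (D - 1), by omega⟩
    rw [lfSF_phaseR, lfSF_phaseR] at h1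
    rw [rfSF2_phaseR, rfSF2_phaseR] at h2
    have hb : blockIdx (kSF2 D a Rc sh0 sh1) (Rc + (D - 1) + E) p =
        blockIdx (kSF2 D a Rc sh0 sh1) (Rc + (D - 1) + E) p' := by
      unfold rfMulti at h2
      omega
    have hmod : p % Q = p' % Q := by omega
    have hsum := blockSum_kSF2 D a Rc sh0 sh1 E Q hRc hsh0 hsh1 hinc
    have := eq_of_block_mod Q (kSF2 D a Rc sh0 sh1) (Rc + (D - 1) + E) p p' (by omega)
      (fun m hm => kSF2_le D a Rc sh0 sh1 E Q m ha hQ1 hQE hm) (by rw [hsum]; omega) (by rw [hsum]; omega)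
      hb hmod
    omega

end C047

end TriangleCap

end PercRepro
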